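import Summits.Ventures.PercRepro.ProfileRowAll
import Summits.Ventures.PercRepro.ProfileUnicyclicCircuitLoop

/-!
# PercRepro — THE LOOP INSTANCE OF `RowAll` IS THEOREM A (p10, gen 12; `proofs/P10-AVFULL.md` §20(b))

When `M` has a loop `e`, no set is bi-independent (`biIndepSets_loop_eq_empty`), every unicyclic set with independent
complement contains `e` and has circuit `{e}` (`uniIndepSets_eq_uniIndepSetsCirc_loop`), so `U_{k+1} = P_k(M ∖ e)`
(`card_uniIndepSets_loop`, through ProfileUnicyclicCircuitLoop's `card_uniIndepSetsCirc_loop`) and the symmetrised count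
is `S_k = 2·P_{k−1}(M ∖ e)` (`uniSymm_loop`).  The `RowAll` inequality `(n − k)·(P_{k−1} + S_k) ≤ k·(P_{k+1} + S_{k+1})`
therefore reads `(n − k)·P_{k−1}(M ∖ e) ≤ k·P_k(M ∖ e)`: the unimodality of the bi-independent density of `M ∖ e`
(`n − 1` elements) at `k − 1`, i.e. Theorem A — the named fact `BiIndepDensityLogConcave` through
`biIndepDensity_mono_of_fact`.  So `RowAll` holds on every matroid with a loop, CONDITIONALLY on the named fact
(**`rowAll_loop_of_fact`**); with the free coextension reading of §20 this is the statement that on `M̂ = (M∖e)^ + (p ∥ e)`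
the row is Theorem A for the two-element minor `(M̂/p)∖e`.  Nothing here asserts `RowAll` in general.

* `biIndepSets_loop_eq_empty`, `uniIndepSets_eq_uniIndepSetsCirc_loop`, `card_uniIndepSets_loop`, `uniSymm_loop`;
* **`rowAll_loop_of_fact`** (conditional on the named fact; unconditional everything else).
-/

open scoped Matroid

namespace PercRepro.Cogirth

open Finset ThmH Skew Shadow Profile

variable {α : Type} [DecidableEq α] {M : Matroid α} [M.Finite] {e : α}

/-- With a loop `e` there is no bi-independent set: `e` lies in `X` or in `E ∖ X`, and a set containing a loop has rank
below its cardinality. -/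
theorem biIndepSets_loop_eq_empty (he : e ∈ gr M) (hl : rk M {e} = 0) (k : ℕ) : biIndepSets M k = ∅ := by
  apply Finset.eq_empty_of_forall_notMem
  intro X hX
  rw [mem_biIndepSets] at hX
  obtain ⟨hXg, -, hXr, hXc⟩ := hX
  have key : ∀ Y : Finset α, Y ⊆ gr M → e ∈ Y → rk M Y ≠ Y.card := by
    intro Y hY heY
    have h1 : rk M Y = rk M (Y.erase e) := by
      conv_lhs => rw [← Finset.insert_erase heY]
      exact rk_insert_loop he hl (Y.erase e) ((Finset.erase_subset e Y).trans hY)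
    have h2 := rk_le_card (M := M) (Y.erase e)
    have h3 := Finset.card_erase_of_mem heY
    have h4 := Finset.card_pos.2 ⟨e, heY⟩
    omega
  by_cases heX : e ∈ X
  · exact key X hXg heX hXr
  · exact key (gr M \ X) sdiff_subset (Finset.mem_sdiff.2 ⟨he, heX⟩) hXc

/-- With a loop `e`, every unicyclic set with independent complement contains `e` and has circuit `{e}`:
`uniIndepSets M k = uniIndepSetsCirc M {e} k`. -/
theorem uniIndepSets_eq_uniIndepSetsCirc_loop (he : e ∈ gr M) (hl : rk M {e} = 0) (k : ℕ) :
    uniIndepSets M k = uniIndepSetsCirc M {e} k := by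
  ext X
  rw [mem_uniIndepSetsCirc]
  constructor
  · intro hX
    refine ⟨hX, ?_⟩
    rw [mem_uniIndepSets] at hX
    obtain ⟨hXg, -, hXr, hXc⟩ := hX
    -- `e ∈ X`: otherwise the complement contains the loop and is dependent
    have heX : e ∈ X := by
      by_contra heX
      have heC : e ∈ gr M \ X := Finset.mem_sdiff.2 ⟨he, heX⟩
      have h1 : rk M (gr M \ X) = rk M ((gr M \ X).erase e) := by
        conv_lhs => rw [← Finset.insert_erase heC]
        exact rk_insert_loop he hl _ ((Finset.erase_subset e _).trans sdiff_subset)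
      have h2 := rk_le_card (M := M) ((gr M \ X).erase e)
      have h3 := Finset.card_erase_of_mem heC
      have h4 := Finset.card_pos.2 ⟨e, heC⟩
      omega
    ext x
    rw [mem_circ, Finset.mem_singleton]
    constructor
    · rintro ⟨hxX, hx⟩
      by_contra hxe
      -- `x ≠ e`: `X.erase x` still contains the loop, so its rank is below its cardinality
      have heY : e ∈ X.erase x := Finset.mem_erase.2 ⟨fun h => hxe h.symm, heX⟩
      have h1 : rk M (X.erase x) = rk M ((X.erase x).erase e) := by
        conv_lhs => rw [← Finset.insert_erase heY]
        exact rk_insert_loop he hl _ ((Finset.erase_subset e _).trans ((Finset.erase_subset x X).trans hXg))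
      have h2 := rk_le_card (M := M) ((X.erase x).erase e)
      have h3 := Finset.card_erase_of_mem heY
      have h4 := Finset.card_pos.2 ⟨e, heY⟩
      omega
    · rintro rfl
      refine ⟨heX, ?_⟩
      have h1 : rk M X = rk M (X.erase x) := by
        conv_lhs => rw [← Finset.insert_erase heX]
        exact rk_insert_loop he hl _ ((Finset.erase_subset x X).trans hXg)
      have h3 := Finset.card_erase_of_mem heX
      omega
  · exact fun h => h.1

/-- With a loop `e`: `U_{k+1} = P_k(M ∖ e)`. -/
theorem card_uniIndepSets_loop (he : e ∈ gr M) (hl : rk M {e} = 0) (k : ℕ) :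
    (uniIndepSets M (k + 1)).card = (biIndepSets (M ＼ ({e} : Set α)) k).card := by
  rw [uniIndepSets_eq_uniIndepSetsCirc_loop he hl, card_uniIndepSetsCirc_loop he hl]

/-- With a loop `e`: `U_0 = 0`. -/
theorem card_uniIndepSets_loop_zero (he : e ∈ gr M) (hl : rk M {e} = 0) :
    (uniIndepSets M 0).card = 0 := by
  rw [uniIndepSets_eq_uniIndepSetsCirc_loop he hl, uniIndepSetsCirc_zero, card_empty]

/-- With a loop `e` and `1 ≤ k ≤ #E`: `S_k = 2·P_{k−1}(M ∖ e)` (the two halves are mirror images on `n − 1` elements). -/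
theorem uniSymm_loop (he : e ∈ gr M) (hl : rk M {e} = 0) {k : ℕ} (hk1 : 1 ≤ k) (hkn : k ≤ (gr M).card) :
    uniSymm M k = 2 * (biIndepSets (M ＼ ({e} : Set α)) (k - 1)).card := by
  unfold uniSymm
  have hcard : (gr (M ＼ ({e} : Set α))).card = (gr M).card - 1 := by
    rw [gr_delete', Finset.card_erase_of_mem he]
  have e1 : (uniIndepSets M k).card = (biIndepSets (M ＼ ({e} : Set α)) (k - 1)).card := by
    have := card_uniIndepSets_loop he hl (k - 1)
    rwa [show k - 1 + 1 = k by omega] at this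
  have e2 : (uniIndepSets M ((gr M).card + 1 - k)).card =
      (biIndepSets (M ＼ ({e} : Set α)) ((gr M).card - k)).card := by
    have := card_uniIndepSets_loop he hl ((gr M).card - k)
    rwa [show (gr M).card - k + 1 = (gr M).card + 1 - k by omega] at this
  have e3 : (biIndepSets (M ＼ ({e} : Set α)) ((gr M).card - k)).card =
      (biIndepSets (M ＼ ({e} : Set α)) (k - 1)).card := by
    rw [card_biIndepSets_symm (M ＼ ({e} : Set α)) (k := (gr M).card - k) (by omega), hcard]
    congr 2
    omega
  rw [e1, e2, e3]
  ring

/-- **THE LOOP INSTANCE OF `RowAll` IS THEOREM A**: on a matroid with a loop `e`, the `RowAll` inequality at level `k`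
is `(n − k)·P_{k−1}(M ∖ e) ≤ k·P_k(M ∖ e)`, the unimodality of the bi-independent density of `M ∖ e` — the named fact
`BiIndepDensityLogConcave` (CONDITIONAL on it; everything else in this file is unconditional). -/
theorem rowAll_loop_of_fact (hfact : BiIndepDensityLogConcave α) (M : Matroid α) [M.Finite] {e : α}
    (he : e ∈ gr M) (hl : rk M {e} = 0) (k : ℕ) (hk1 : 1 ≤ k) (hk : 2 * k + 1 ≤ (gr M).card) :
    ((gr M).card - k) * ((biIndepSets M (k - 1)).card + uniSymm M k) ≤
      k * ((biIndepSets M (k + 1)).card + uniSymm M (k + 1)) := by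
  rw [biIndepSets_loop_eq_empty he hl, biIndepSets_loop_eq_empty he hl, card_empty,
    uniSymm_loop he hl hk1 (by omega), uniSymm_loop he hl (by omega) (by omega),
    show k + 1 - 1 = k by omega]
  have hcard : (gr (M ＼ ({e} : Set α))).card = (gr M).card - 1 := by
    rw [gr_delete', Finset.card_erase_of_mem he]
  have hmono := biIndepDensity_mono_of_fact hfact (M ＼ ({e} : Set α)) (k - 1) (by omega)
  rw [hcard, show k - 1 + 1 = k by omega, show (gr M).card - 1 - (k - 1) = (gr M).card - k by omega] at hmono
  simp only [zero_add]
  nlinarith [hmono]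

end PercRepro.Cogirth
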